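import Summits.NavierStokesRegularity.NavierStokesRegularity.Theses.QuantisedSymmetry
import Summits.NavierStokesRegularity.NavierStokesRegularity.Theses.Blowup
import Summits.NavierStokesRegularity.NavierStokesRegularity.Theorems.QuantisedSymmetryPolyhedralDssProfileExistsLerayOrbitOfProfile
import Summits.NavierStokesRegularity.NavierStokesRegularity.Theorems.QuantisedSymmetryPolyhedralDssProfileExistsDominatesBlowupProfile
import Summits.NavierStokesRegularity.NavierStokesRegularity.Theorems.QuantisedSymmetryLiouvilleKillsProfile
import Literature.Analysis.FluidPDE.SelfSimilarLiouville
import HarnessLib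

/-!
# Strategist census s20 (independent, family `-s`) — typed inventory for crux
# `QuantisedSymmetry.PolyhedralDssProfileExists` (stmt-NavierStokesRegularity-1404)

This scratch file accompanies `STRATEGY-CENSUS-s20.md`. It TYPES the candidate replacements /
splits of the crux that the census discusses and proves the (trivial or in-tree) implications
between them, so that the census can say precisely which piece "remains the whole crux".
Nothing here is a route item; nothing here is sorried.

* `W1`  = `Blowup.BlowupTypeIDssProfile` (drop the polyhedral group): crux ⇒ W1 is the landed
  `stub_dominatesBlowupProfile`; W1 is itself the OPEN deciding crux of route `Blowup`.
* `W2poly` = a nontrivial polyhedrally-equivariant Type-I BOUNDED ANCIENT mild solution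
  (no self-similarity) = `¬ PolyhedralTypeILiouville`; crux ⇒ W2poly via the landed
  `quantisedSymmetry_liouvilleKillsProfile_proof`.  No bridge W2poly ⇒ Clay blow-up is known
  (Albritton–Barker 2019 Thm 1.1 reaches only a LOCAL singular suitable weak solution).
* bridge split (D-d): `W2poly ∧ DssSelection → crux`, seam = modus ponens (proved below).
* CAP split (D-c): `ApproxOrbit δ ε ∧ NKCloses δ ε → crux` via the landed
  `polyhedralDssProfileExists_of_periodicLerayOrbit`; seam proved below; the content of a real
  Newton–Kantorovich theorem (a certified bound on the Floquet resolvent of the linearised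
  period map) is NOT expressible over existing declarations and is described in the census.
* `SteadyPolyhedralProfileExists` (S⁺, continuous self-similarity) lies in the REFUTED regime
  of the named facts `necas_ruzicka_sverak` / `tsai_selfsimilar` (stated, not re-proved here).
-/

noncomputable section

set_option linter.dupNamespace false

namespace Summit.NavierStokesRegularity.NavierStokesRegularity.Cruxes.PolyhedralDssProfileExists.StrategistS20

open Set MeasureTheory Literature.Analysis.FluidPDE
open Summit.NavierStokesRegularity.NavierStokesRegularity.Theses

local notation "E3" => EuclideanSpace ℝ (Fin 3)

/-- The crux, by name. -/
abbrev Crux : Prop := QuantisedSymmetry.PolyhedralDssProfileExists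

/-- Finite irreducible proper rotation group (the three group-theoretic clauses of the crux). -/
def IsPolyhedral (G : Subgroup (E3 ≃ₗᵢ[ℝ] E3)) : Prop :=
  Finite G ∧ (∀ g ∈ G, LinearMap.det (g.toLinearEquiv : E3 →ₗ[ℝ] E3) = 1) ∧
    (∀ V : Submodule ℝ E3, (∀ g ∈ G, ∀ v ∈ V, g v ∈ V) → V = ⊥ ∨ V = ⊤)

/-! ## (1) Weaker intermediates read off the summit path -/

/-- **W1** (sector-free Type-I DSS profile) is implied by the crux: landed. -/
theorem w1_of_crux : Crux → Blowup.BlowupTypeIDssProfile :=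
  Theorems.PolyhedralDssProfileExists.PolyhedralCell.stub_dominatesBlowupProfile

/-- **W2poly**: a nontrivial Type-I polyhedrally-equivariant BOUNDED ANCIENT mild solution
(self-similarity dropped). -/
def W2poly : Prop :=
  ∃ G : Subgroup (E3 ≃ₗᵢ[ℝ] E3), IsPolyhedral G ∧
    ∃ u : ℝ → E3 → E3, IsBoundedAncientMildSolution 1 u ∧ (∀ t < 0, AEStronglyMeasurable (u t) volume) ∧
      (∃ C₀ : ℝ, HasTypeIDecay C₀ u) ∧ (∀ g ∈ G, ∀ t x, u t (g x) = g (u t x)) ∧ ¬ (∀ t < 0, u t =ᵐ[volume] 0)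

/-- W2poly is literally the negation of the route's kill switch `PolyhedralTypeILiouville`. -/
theorem w2poly_iff_not_liouville : W2poly ↔ ¬ QuantisedSymmetry.PolyhedralTypeILiouville := by
  constructor
  · rintro ⟨G, ⟨hfin, hdet, hirr⟩, u, hanc, hmeas, hdec, heqv, hnt⟩ hL
    exact hnt (hL G hfin hdet hirr u hanc hmeas hdec heqv)
  · intro h
    by_contra hW
    apply h
    intro G hfin hdet hirr u hanc hmeas hdec heqv
    by_contra hnt
    exact hW ⟨G, ⟨hfin, hdet, hirr⟩, u, hanc, hmeas, hdec, heqv, hnt⟩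

/-- **crux ⇒ W2poly** (landed: `LiouvilleKillsProfile` = `PolyhedralTypeILiouville → ¬ crux`). -/
theorem w2poly_of_crux : Crux → W2poly := by
  intro hX
  rw [w2poly_iff_not_liouville]
  intro hL
  exact Theorems.quantisedSymmetry_liouvilleKillsProfile_proof hL hX

/-! ## (2) Decompositions -/

/-- **D-d, selection piece**: among polyhedral Type-I ancient solutions one can select a
discretely self-similar one.  No mechanism in print (census § Decomposition). -/
def DssSelection : Prop := W2poly → Crux

/-- D-d assembly (modus ponens; `trivial_seam`). -/
theorem crux_of_bridgeSplit (h₁ : W2poly) (h₂ : DssSelection) : Crux := h₂ h₁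

/-- The periodic-Leray-orbit form of the crux (certified `↔` in tree). -/
def PeriodicLerayOrbitExists : Prop :=
  ∃ G : Subgroup (E3 ≃ₗᵢ[ℝ] E3), Finite G ∧
    (∀ g ∈ G, LinearMap.det (g.toLinearEquiv : E3 →ₗ[ℝ] E3) = 1) ∧
    (∀ V : Submodule ℝ E3, (∀ g ∈ G, ∀ v ∈ V, g v ∈ V) → V = ⊥ ∨ V = ⊤) ∧
    ∃ S : ℝ, 0 < S ∧ ∃ (U : ℝ → E3 → E3) (P : ℝ → E3 → ℝ),
      IsBackwardLeraySolutionOn univ 1 U P ∧ Function.Periodic U S ∧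
      (∃ C₀ : ℝ, ∀ s y, (1 + ‖y‖) * ‖U s y‖ ≤ C₀) ∧
      (∀ g ∈ G, ∀ s y, U s (g y) = g (U s y)) ∧ (∃ s y, U s y ≠ 0)

theorem crux_iff_orbit : Crux ↔ PeriodicLerayOrbitExists :=
  Theorems.PolyhedralDssProfileExists.PolyhedralCell.polyhedralDssProfileExists_iff_periodicLerayOrbit

/-- **D-c, candidate piece**: an `ε`-approximate `S`-periodic polyhedral orbit of the backward
Leray system — a classical solution of the system with an extra force `R` (the residual),
`(1+|y|)³|R| ≤ ε`, Type-I profile bound, amplitude at least `δ` somewhere (to stay off the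
trivial orbit, cf. `stub_noSmallCell`). -/
def ApproxOrbit (δ ε : ℝ) : Prop :=
  ∃ G : Subgroup (E3 ≃ₗᵢ[ℝ] E3), IsPolyhedral G ∧
    ∃ S : ℝ, 0 < S ∧ ∃ (U R : ℝ → E3 → E3) (P : ℝ → E3 → ℝ),
      IsClassicalNSSolutionOn univ 1 (fun s y => rescaledEulerLerayForce 1 U s y + R s y) U P ∧
      Function.Periodic U S ∧ Function.Periodic R S ∧
      (∃ C₀ : ℝ, ∀ s y, (1 + ‖y‖) * ‖U s y‖ ≤ C₀) ∧
      (∀ g ∈ G, ∀ s y, U s (g y) = g (U s y)) ∧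
      (∀ s y, (1 + ‖y‖) ^ 3 * ‖R s y‖ ≤ ε) ∧ (∃ s y, δ ≤ ‖U s y‖)

/-- **D-c, closing piece** (placeholder for a Newton–Kantorovich theorem: AS TYPED it omits the
certified Floquet-resolvent bound that carries all the content; see census). -/
def NKCloses (δ ε : ℝ) : Prop := ApproxOrbit δ ε → PeriodicLerayOrbitExists

/-- D-c assembly: modus ponens + the landed orbit ⇒ crux direction. -/
theorem crux_of_capSplit (δ ε : ℝ) (h₁ : ApproxOrbit δ ε) (h₂ : NKCloses δ ε) : Crux :=
  crux_iff_orbit.2 (h₂ h₁)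

/-- An exact orbit is a `0`-approximate orbit (so `ApproxOrbit δ 0` for small `δ` is implied by
the crux up to the amplitude normalisation; recorded to show piece 1 is not vacuous in form). -/
theorem approxOrbit_of_orbit_amplitude {δ : ℝ}
    (h : ∃ G : Subgroup (E3 ≃ₗᵢ[ℝ] E3), IsPolyhedral G ∧
      ∃ S : ℝ, 0 < S ∧ ∃ (U : ℝ → E3 → E3) (P : ℝ → E3 → ℝ),
        IsBackwardLeraySolutionOn univ 1 U P ∧ Function.Periodic U S ∧
        (∃ C₀ : ℝ, ∀ s y, (1 + ‖y‖) * ‖U s y‖ ≤ C₀) ∧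
        (∀ g ∈ G, ∀ s y, U s (g y) = g (U s y)) ∧ (∃ s y, δ ≤ ‖U s y‖)) :
    ApproxOrbit δ 0 := by
  obtain ⟨G, hG, S, hS, U, P, hsol, hper, hC, heqv, hamp⟩ := h
  refine ⟨G, hG, S, hS, U, fun _ _ => 0, P, ?_, hper, ?_, hC, heqv, ?_, hamp⟩
  · show IsClassicalNSSolutionOn univ 1 (fun s y => rescaledEulerLerayForce 1 U s y + 0) U P
    simp only [add_zero]
    exact hsol
  · intro s; rfl
  · intro s y; simp

/-! ## (3) Strengthening: continuous self-similarity is the refuted regime -/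

/-- **S⁺ (steady polyhedral Leray profile)**: a nonzero `C²` solution of Leray's profile system
with the Type-I profile bound. By `tsai_selfsimilar` (Tsai 1998 Thm 1; the bound puts `U` in
every `L^q`, `q > 3`) this is the REFUTED regime — stated here only to fix the signature the
census refers to. -/
def SteadyPolyhedralProfileExists : Prop :=
  ∃ G : Subgroup (E3 ≃ₗᵢ[ℝ] E3), IsPolyhedral G ∧
    ∃ (U : E3 → E3) (P : E3 → ℝ), IsLerayProfile 1 (1 / 2) U P ∧
      (∃ C₀ : ℝ, ∀ y, (1 + ‖y‖) * ‖U y‖ ≤ C₀) ∧ (∀ g ∈ G, ∀ y, U (g y) = g (U y)) ∧ U ≠ 0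

end Summit.NavierStokesRegularity.NavierStokesRegularity.Cruxes.PolyhedralDssProfileExists.StrategistS20

end
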